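import Summits.HubbardSuperconductivity.HubbardSuperconductivity.Theorems.AnisotropyChordTransferFibre3FinXCCell
import Summits.HubbardSuperconductivity.HubbardSuperconductivity.Theorems.AnisotropyChordTransferFibre3FinXBCover
import Summits.HubbardSuperconductivity.HubbardSuperconductivity.Theorems.AnisotropyChordTransferFibre3KT2Assembly

/-!
# Route `AnisotropyChord` / H0 rotor rung: FIN small-`L` — the λ-cell cover of the COMBINED certificate: rows `N₁` and C per `L`

Packaging of `…Fibre3FinXCCell.xbc_cell_sound` over a list of cells `(pᵢ, cᵢ, bnᵢ)` (common denominator `bd` for `b`),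
covering `λ₂·D ∈ [0, lamTop L]`, each cell vacuous (as in `…FinXBCover.xbCellAny`) or certified by `xbcCellOK`:
`xbcCellAny`, `cellsAllC`, `cellsLastC`, ★ `xbcCheck L Δ₁ bd cells`; `cover_allC`; ★ `xbc_of_check` (per profile: its cell's
`c·U ≤ N₁` and the row-C bracket tuple); ★★ `trialGapAbs_of_xbcCheck` and ★★ `offPoleTailAbs_of_xbcCheck`
(`OffPoleTailAbs L Δ (bmax/bd)` for any `bmax` above every cell's `bn`, via p1's `KT2Assembly.offPoleTailAbs_of_brackets`).
Prover seat `hubbard-h0-rotor-p3` g5; helper for piece A = stmt-HubbardSuperconductivity-23918 of rung 19089 (`--supports`, helper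
class).  WHAT THIS IS NOT: nothing here proves superconductivity in the Hubbard model (rotor TARGET as worded stays FALSE, g15 verdict);
the FIN form of two hypotheses (rows `N₁`, C) of ONE conditional reduction.  Tree imports only; no sorry, no new axioms.
-/

set_option linter.dupNamespace false
set_option autoImplicit false

namespace Summit.HubbardSuperconductivity.HubbardSuperconductivity.Theorems.AnisotropyChord.Transfer.Fibre3

namespace FinXB

open scoped BigOperators
open Finset Hole2 FinCell

/-! ## The per-`L` combined certificate (computable) -/

/-- one cell `[la, lb]` with constants `(c, bn)`: vacuous (numerator / `Δ < 0` / `Δ > Δ₁`) or certified by `xbcCellOK`. -/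
def xbcCellAny (L : ℕ) (d1 : ℚ) (bd : ℕ) (la lb : ℤ) (cb : ℚ × ℕ) : Bool :=
  (denCellPos L (cosTab L) la lb && decide ((numIv L la lb).2 < 0) && decide (0 ≤ (G0Iv L la lb).1)) ||
  (groundCellCheck L la lb &&
    (decide ((deltaIv L la lb).2 < 0) || decide (d1 * (D : ℚ) < (((deltaIv L la lb).1 : ℤ) : ℚ)))) ||
  xbcCellOK L la lb cb.1 cb.2 bd

/-- pairwise check of consecutive points. -/
def cellsAllC (ok : ℤ → ℤ → ℚ × ℕ → Bool) : List (ℤ × ℚ × ℕ) → Bool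
  | [] => true
  | [_] => true
  | a :: b :: rest => ok a.1 b.1 a.2 && cellsAllC ok (b :: rest)

/-- the last point. -/
def cellsLastC : List (ℤ × ℚ × ℕ) → ℤ
  | [] => 0
  | [a] => a.1
  | _ :: b :: rest => cellsLastC (b :: rest)

/-- ★ THE PER-`L` COMBINED CERTIFICATE on `0 < Δ ≤ Δ₁`. -/
def xbcCheck (L : ℕ) (d1 : ℚ) (bd : ℕ) (cells : List (ℤ × ℚ × ℕ)) : Bool :=
  decide ((cells.head?.map Prod.fst) = some 0) && decide (2 ≤ cells.length) && decide (lamTop L ≤ cellsLastC cells)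
    && decide (0 < bd) && cellsAllC (xbcCellAny L d1 bd) cells

/-! ## The cover -/

/-- the arithmetic cover. [folklore] -/
theorem cover_allC (ok : ℤ → ℤ → ℚ × ℕ → Bool) : ∀ (rest : List (ℤ × ℚ × ℕ)) (a b : ℤ × ℚ × ℕ) (x : ℝ),
    cellsAllC ok (a :: b :: rest) = true → (a.1 : ℝ) ≤ x → x ≤ ((cellsLastC (a :: b :: rest) : ℤ) : ℝ) →
    ∃ c d : ℤ, ∃ q : ℚ × ℕ, ok c d q = true ∧ (c : ℝ) ≤ x ∧ x ≤ (d : ℝ) ∧ q ∈ (a :: b :: rest).map Prod.snd := by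
  intro rest
  induction rest with
  | nil =>
    intro a b x hok ha hb
    unfold cellsAllC at hok
    rw [Bool.and_eq_true] at hok
    exact ⟨a.1, b.1, a.2, hok.1, ha, by simpa [cellsLastC] using hb, by simp⟩
  | cons r rest ih =>
    intro a b x hok ha hb
    unfold cellsAllC at hok
    rw [Bool.and_eq_true] at hok
    by_cases hxb : x ≤ (b.1 : ℝ)
    · exact ⟨a.1, b.1, a.2, hok.1, ha, hxb, by simp⟩
    · push Not at hxb
      have hb' : x ≤ ((cellsLastC (b :: r :: rest) : ℤ) : ℝ) := by simpa [cellsLastC] using hb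
      obtain ⟨c, d, q, hcd, hc, hd, hq⟩ := ih b r x hok.2 hxb.le hb'
      exact ⟨c, d, q, hcd, hc, hd, by simp only [List.map_cons, List.mem_cons] at hq ⊢; tauto⟩

/-- the per-profile conclusion of a certified cell with constants `(c, bn)` and denominator `bd`. -/
def CellConclusion (L : ℕ) [NeZero L] (Δ lam2 : ℝ) (f : Tor L → ℝ) (c : ℚ) (bn bd : ℕ) : Prop :=
  (c : ℝ) * Uunit L Δ f ≤ trialGapN1 L Δ f ∧
    ∃ Chi Nhi Plo Llo Tlo Thi : ℝ,
      cs2 L f ≤ Chi ∧ nC0p L Δ f ≤ Nhi ∧ Plo ≤ polePart L Δ f ∧ Llo ≤ lowNormPart L Δ f ∧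
      Tlo ≤ Tplus L Δ f ∧ Tplus L Δ f ≤ Thi ∧ Thi ≤ 2 * eps1 L ∧ 0 ≤ Tlo ∧
      (3 * Real.sqrt Chi + 3 * Real.sqrt Nhi) ^ 2 - Plo - Llo
        ≤ ((bn : ℝ) / bd) * ((L : ℝ) ^ 2 * lam2 / 4) * (2 * eps1 L - Thi) * (3 * ((L : ℝ) ^ 2) ^ 2 * Tlo)

/-- one cell of the combined certificate. [folklore] -/
theorem xbc_cellAny_sound (L : ℕ) [NeZero L] (hL : 5 ≤ L) {d1 : ℚ} {bd : ℕ} {Δ lam2 : ℝ} (hΔ0 : 0 < Δ)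
    (hΔd : Δ ≤ (d1 : ℝ)) (hΔ1 : Δ < 1) {f : Tor L → ℝ} (hf : IsGroundTwoMagnon L Δ lam2 f) {la lb : ℤ}
    (hla : (la : ℝ) ≤ lam2 * ((D : ℤ) : ℝ)) (hlb : lam2 * ((D : ℤ) : ℝ) ≤ (lb : ℝ)) {cb : ℚ × ℕ}
    (hok : xbcCellAny L d1 bd la lb cb = true) : CellConclusion L Δ lam2 f cb.1 cb.2 bd := by
  have hL3 : 3 ≤ L := by omega
  have hD := D_pos
  have hlam : 0 < lam2 := lam2_pos L hL3 hΔ1 hf.1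
  have hΔe : Δ = deltaOfLam L lam2 := ground_delta_eq L hL hΔ0.le hΔ1 hf
  unfold xbcCellAny at hok
  simp only [Bool.or_eq_true, Bool.and_eq_true, decide_eq_true_eq] at hok
  rcases hok with (⟨⟨hpos, hnum⟩, hG0⟩ | ⟨hgc, hvac⟩) | hcert
  · exact (vacuous_of_num_neg (L := L) hL3 hlam hla hlb hpos hnum hG0 hΔ0 hΔ1 hΔe).elim
  · exfalso
    have hmd := mem_delta_cell L hL3 hlam hla hlb hgc
    rw [← hΔe] at hmd
    obtain ⟨hlo, hhi⟩ := hmd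
    rcases hvac with hneg | hbig
    · have : ((((deltaIv L la lb).2 : ℤ)) : ℝ) < 0 := by exact_mod_cast hneg
      nlinarith
    · have hbig' : (d1 : ℝ) * ((D : ℤ) : ℝ) < ((((deltaIv L la lb).1 : ℤ)) : ℝ) := by
        have e : (((D : ℚ)) : ℝ) = ((D : ℤ) : ℝ) := by norm_cast
        rw [← e]; exact_mod_cast hbig
      nlinarith
  · exact xbc_cell_sound hL hΔ0 hΔ1 hf hla hlb hcert

/-- ★ from the per-`L` combined certificate: every ground profile at `0 < Δ ≤ Δ₁`, `Δ < 1` satisfies the conclusions of its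
cell. [folklore] -/
theorem xbc_of_check (L : ℕ) [NeZero L] (hL : 7 ≤ L) {d1 : ℚ} {bd : ℕ} {cells : List (ℤ × ℚ × ℕ)}
    (h : xbcCheck L d1 bd cells = true) {Δ : ℝ} (hΔ0 : 0 < Δ) (hΔd : Δ ≤ (d1 : ℝ)) (hΔ1 : Δ < 1) :
    ∀ lam2 : ℝ, ∀ f : Tor L → ℝ, IsGroundTwoMagnon L Δ lam2 f →
      ∃ cb ∈ cells.map Prod.snd, CellConclusion L Δ lam2 f cb.1 cb.2 bd := by
  refine forall_ground_of_window_7 L hL hΔ0.le hΔ1 _ ?_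
  intro lam2 f hf hlam0 hlamle
  have hD := D_pos
  unfold xbcCheck at h
  simp only [Bool.and_eq_true, decide_eq_true_eq] at h
  obtain ⟨⟨⟨⟨hhead, hlen⟩, htop⟩, _⟩, hok⟩ := h
  obtain ⟨a, b, rest, hcells⟩ : ∃ a b : ℤ × ℚ × ℕ, ∃ rest : List (ℤ × ℚ × ℕ), cells = a :: b :: rest := by
    match cells, hlen with
    | a :: b :: rest, _ => exact ⟨a, b, rest, rfl⟩
  subst hcells
  have ha0 : a.1 = 0 := by simpa using hhead
  set x : ℝ := lam2 * ((D : ℤ) : ℝ) with hx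
  have hx0 : (a.1 : ℝ) ≤ x := by rw [ha0, hx]; push_cast; positivity
  have hxtop : x ≤ ((cellsLastC (a :: b :: rest) : ℤ) : ℝ) :=
    (lam_mul_D_le_lamTop L (by omega) hlamle).trans (by exact_mod_cast htop)
  obtain ⟨c, d, q, hcell, hcx, hxd, hq⟩ := cover_allC (xbcCellAny L d1 bd) rest a b x hok hx0 hxtop
  exact ⟨q, hq, xbc_cellAny_sound L (by omega) hΔ0 hΔd hΔ1 hf hcx hxd hcell⟩

/-- ★★ ROW `N₁` from the combined certificate (uniform constant). [folklore] -/
theorem trialGapAbs_of_xbcCheck (L : ℕ) [NeZero L] (hL : 7 ≤ L) {d1 : ℚ} {bd : ℕ} {cells : List (ℤ × ℚ × ℕ)}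
    (h : xbcCheck L d1 bd cells = true) {c : ℚ} (hc : ∀ cb ∈ cells.map Prod.snd, c ≤ cb.1)
    {Δ : ℝ} (hΔ0 : 0 < Δ) (hΔd : Δ ≤ (d1 : ℝ)) (hΔ1 : Δ < 1) : TrialGapAbs L Δ c := by
  intro lam2 f hf
  obtain ⟨cb, hcb, hconc, -⟩ := xbc_of_check L hL h hΔ0 hΔd hΔ1 lam2 f hf
  have hU : 0 < Uunit L Δ f := by
    unfold Uunit
    have hT := Tplus_pos L (by omega) hΔ1 hf
    have hLpos : (0 : ℝ) < L := by exact_mod_cast (show 0 < L by omega)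
    positivity
  have hcq : ((c : ℚ) : ℝ) ≤ ((cb.1 : ℚ) : ℝ) := by exact_mod_cast hc cb hcb
  exact (mul_le_mul_of_nonneg_right hcq hU.le).trans hconc

/-- ★★ ROW C (KT-2b″) from the combined certificate: `OffPoleTailAbs L Δ (bmax/bd)` for any `bmax` above every cell's `bn`. [folklore] -/
theorem offPoleTailAbs_of_xbcCheck (L : ℕ) [NeZero L] (hL : 7 ≤ L) {d1 : ℚ} {bd : ℕ} {cells : List (ℤ × ℚ × ℕ)}
    (h : xbcCheck L d1 bd cells = true) {bmax : ℕ} (hb : ∀ cb ∈ cells.map Prod.snd, cb.2 ≤ bmax)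
    {Δ : ℝ} (hΔ0 : 0 < Δ) (hΔd : Δ ≤ (d1 : ℝ)) (hΔ1 : Δ < 1) : OffPoleTailAbs L Δ ((bmax : ℝ) / bd) := by
  have hbd : 0 < bd := by
    unfold xbcCheck at h
    simp only [Bool.and_eq_true, decide_eq_true_eq] at h
    exact h.1.2
  refine KT2Assembly.offPoleTailAbs_of_brackets L (by omega) hΔ1 (by positivity) ?_
  intro lam2 f hf
  obtain ⟨cb, hcb, -, Chi, Nhi, Plo, Llo, Tlo, Thi, hC, hN, hP, hLo, hTlo, hThi, hT2, hTlo0, hineq⟩ :=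
    xbc_of_check L hL h hΔ0 hΔd hΔ1 lam2 f hf
  refine ⟨Chi, Nhi, Plo, Llo, Tlo, Thi, hC, hN, hP, hLo, hTlo, hThi, hT2, hTlo0, hineq.trans ?_⟩
  have hlam : 0 < lam2 := lam2_pos L (by omega) hΔ1 hf.1
  have hLpos : (0 : ℝ) < L := by exact_mod_cast (show 0 < L by omega)
  have hbdR : (0 : ℝ) < bd := by exact_mod_cast hbd
  have hbb : (cb.2 : ℝ) / bd ≤ (bmax : ℝ) / bd := by
    have : (cb.2 : ℝ) ≤ bmax := by exact_mod_cast hb cb hcb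
    exact div_le_div_of_nonneg_right this hbdR.le
  have hrest : 0 ≤ ((L : ℝ) ^ 2 * lam2 / 4) * (2 * eps1 L - Thi) * (3 * ((L : ℝ) ^ 2) ^ 2 * Tlo) := by
    have h1 : 0 ≤ 2 * eps1 L - Thi := by linarith
    positivity
  have := mul_le_mul_of_nonneg_right hbb hrest
  linarith [this]

end FinXB

end Summit.HubbardSuperconductivity.HubbardSuperconductivity.Theorems.AnisotropyChord.Transfer.Fibre3
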